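import Literature.Analysis.Pluripotential.LelongNumberComparison
import Literature.Analysis.Pluripotential.EffectiveDivisorCurrent
import Literature.Analysis.Pluripotential.MaxLogPolynomialCurrent
import HarnessLib

/-!
# Currents with the same singularities: bounded differences of cone potentials, and Siu's
theorem for currents with algebraic analytic singularities

Topic `Literature/Analysis/Pluripotential`. Two closed positive `(1,1)`-currents `T, T'` on
`ℙᴺ(ℂ)` have the **same singularities** when their cone potentials differ by a locally bounded
function on `ℂ^{N+1} ∖ {0}` (`ClosedPositiveOneOneCurrent.HasBoundedDifference`, a definition
with body: `V ≤ V' + C` and `V' ≤ V + C` near every `v ≠ 0`). Bounded perturbations do not change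
the admissible slopes (`lelongSlopes_subset_of_eventually_le_add_coe`), hence neither the Lelong
numbers (`HasBoundedDifference.lelongNumber_eq`) nor the upper level sets
(`HasBoundedDifference.lelongUpperLevelSet_eq`); so **Siu's theorem transfers along bounded
differences** (`HasBoundedDifference.isAnalyticSet_lelongUpperLevelSet`). Combined with the
algebraic model currents this proves Siu's theorem for every current with **algebraic analytic
singularities** in the usual sense — cone potential `(c/d) log maxₖ |Fₖ| + O(1)`
(equivalently `(c/2d) log Σₖ |Fₖ|² + O(1)`), `isAnalyticSet_lelongUpperLevelSet_of_hasBoundedDifference_max` —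
and for every current with the singularities of an effective `ℝ`-divisor,
`Σₖ (aₖ/dₖ) log |Fₖ| + O(1)` (`isAnalyticSet_lelongUpperLevelSet_of_hasBoundedDifference_divisor`).

## References

* [Siu1974] Y.-T. Siu, Analyticity of sets associated to Lelong numbers and the extension of
  closed positive currents, Invent. Math. 27 (1974): Main Theorem.
* [HormanderSCV1973] L. Hörmander, An introduction to complex analysis in several variables
  (1973), §2.6; L. Hörmander, Notions of Convexity (1994), §4.1 (Lelong numbers depend only on the
  singularities).
-/

noncomputable section

open scoped Topology ENNReal Manifold ContDiff LinearAlgebra.Projectivization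
open Filter Set Metric MvPolynomial

namespace Literature.Analysis.Pluripotential

variable {E : Type*} [NormedAddCommGroup E]

/-- A one-sided bounded comparison `u ≤ v + C` near `a` transfers admissible slopes from `v` to
`u`. [folklore] -/
theorem lelongSlopes_subset_of_eventually_le_add_coe {u v : E → EReal} {a : E} {C : ℝ}
    (h : ∀ᶠ z in 𝓝[≠] a, u z ≤ v z + (C : EReal)) : lelongSlopes v a ⊆ lelongSlopes u a := by
  rintro γ ⟨hγ0, C', hC'⟩
  refine ⟨hγ0, C' + C, ?_⟩
  filter_upwards [h, hC'] with z hz hz'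
  refine hz.trans ((add_le_add_left hz' _).trans_eq ?_)
  rw [← EReal.coe_add]
  congr 1; ring

/-- **Lelong numbers depend only on the singularities**: if `u ≤ v + C` and `v ≤ u + C` near `a`,
then `ν(u, a) = ν(v, a)`. [cite: HormanderSCV1973, §2.6; folklore] -/
theorem lelongNumber_eq_of_eventually_le_add_coe {u v : E → EReal} {a : E} {C : ℝ}
    (huv : ∀ᶠ z in 𝓝[≠] a, u z ≤ v z + (C : EReal)) (hvu : ∀ᶠ z in 𝓝[≠] a, v z ≤ u z + (C : EReal)) :
    lelongNumber u a = lelongNumber v a := by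
  rw [lelongNumber_eq_sSup, lelongNumber_eq_sSup, Subset.antisymm
    (lelongSlopes_subset_of_eventually_le_add_coe hvu) (lelongSlopes_subset_of_eventually_le_add_coe huv)]

namespace ClosedPositiveOneOneCurrent

variable {N : ℕ}

/-- **Currents with the same singularities**: `T` and `T'` have BOUNDED DIFFERENCE if their cone
potentials satisfy `V ≤ V' + C` and `V' ≤ V + C` near every point of `ℂ^{N+1} ∖ {0}` (the
constant depending on the point), i.e. `V - V'` is locally bounded wherever it is defined.
[cite: HormanderSCV1973, §2.6; folklore] -/
def HasBoundedDifference (T T' : ClosedPositiveOneOneCurrent N) : Prop :=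
  ∀ v : Fin (N + 1) → ℂ, v ≠ 0 → ∃ C : ℝ, ∀ᶠ y in 𝓝 v,
    T.pot y ≤ T'.pot y + (C : EReal) ∧ T'.pot y ≤ T.pot y + (C : EReal)

/-- Bounded difference is reflexive. [folklore] -/
theorem HasBoundedDifference.refl (T : ClosedPositiveOneOneCurrent N) : T.HasBoundedDifference T :=
  fun _ _ ↦ ⟨0, Eventually.of_forall fun y ↦ by simp⟩

/-- Bounded difference is symmetric. [folklore] -/
theorem HasBoundedDifference.symm {T T' : ClosedPositiveOneOneCurrent N}
    (h : T.HasBoundedDifference T') : T'.HasBoundedDifference T := fun v hv ↦ by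
  obtain ⟨C, hC⟩ := h v hv
  exact ⟨C, hC.mono fun y hy ↦ ⟨hy.2, hy.1⟩⟩

/-- **Currents with the same singularities have the same Lelong numbers.**
[cite: HormanderSCV1973, §2.6; folklore] -/
theorem HasBoundedDifference.lelongNumber_eq {T T' : ClosedPositiveOneOneCurrent N}
    (h : T.HasBoundedDifference T') (x : ℙ ℂ (Fin (N + 1) → ℂ)) :
    T.lelongNumber x = T'.lelongNumber x := by
  obtain ⟨C, hC⟩ := h x.rep (Projectivization.rep_nonzero x)
  have hC' : ∀ᶠ y in 𝓝[≠] x.rep,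
      T.pot y ≤ T'.pot y + (C : EReal) ∧ T'.pot y ≤ T.pot y + (C : EReal) :=
    mem_nhdsWithin_of_mem_nhds hC
  exact lelongNumber_eq_of_eventually_le_add_coe (hC'.mono fun y hy ↦ hy.1) (hC'.mono fun y hy ↦ hy.2)

/-- **Currents with the same singularities have the same Lelong upper level sets.** [folklore] -/
theorem HasBoundedDifference.lelongUpperLevelSet_eq {T T' : ClosedPositiveOneOneCurrent N}
    (h : T.HasBoundedDifference T') (c : ℝ) :
    T.lelongUpperLevelSet c = T'.lelongUpperLevelSet c := by
  ext x
  rw [mem_lelongUpperLevelSet_iff, mem_lelongUpperLevelSet_iff, h.lelongNumber_eq x]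

/-- **Siu's theorem transfers along bounded differences**: if `T` has the same singularities as
`T'` and the level set `E_c(T')` is analytic, so is `E_c(T)`. [cite: Siu1974, Main Theorem] -/
theorem HasBoundedDifference.isAnalyticSet_lelongUpperLevelSet {T T' : ClosedPositiveOneOneCurrent N}
    (h : T.HasBoundedDifference T') {c : ℝ}
    (hT' : Literature.Geometry.Kaehler.IsAnalyticSet 𝓘(ℂ, Fin N → ℂ) (T'.lelongUpperLevelSet c)) :
    Literature.Geometry.Kaehler.IsAnalyticSet 𝓘(ℂ, Fin N → ℂ) (T.lelongUpperLevelSet c) := by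
  rw [h.lelongUpperLevelSet_eq c]
  exact hT'

/-- **Siu's theorem for currents with algebraic analytic singularities**: if the cone potential of
`T` differs by a locally bounded function from `(c/d) log maxₖ |Fₖ|` (`K ≥ 1` non-zero
homogeneous `Fₖ` of degree `d ≥ 1`, `c ≥ 0`) — equivalently from `(c/2d) log Σₖ |Fₖ|²` — then
every `E_{c'}(T)`, `c' > 0`, is an analytic subset of `ℙᴺ(ℂ)`. [cite: Siu1974, Main Theorem] -/
theorem isAnalyticSet_lelongUpperLevelSet_of_hasBoundedDifference_max {K : ℕ}
    {T : ClosedPositiveOneOneCurrent N} (hK : (Finset.univ : Finset (Fin K)).Nonempty)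
    (F : Fin K → MvPolynomial (Fin (N + 1)) ℂ) (d : ℕ) (hF : ∀ k, (F k).IsHomogeneous d)
    (hd : 0 < d) (hF0 : ∀ k, F k ≠ 0) (c : ℝ) (hc : 0 ≤ c)
    (h : T.HasBoundedDifference (ofHomogeneousPolynomialsMax hK F d hF hd hF0 c hc))
    {c' : ℝ} (hc' : 0 < c') :
    Literature.Geometry.Kaehler.IsAnalyticSet 𝓘(ℂ, Fin N → ℂ) (T.lelongUpperLevelSet c') :=
  h.isAnalyticSet_lelongUpperLevelSet
    (isAnalyticSet_lelongUpperLevelSet_ofHomogeneousPolynomialsMax hK F d hF hd hF0 hc hc')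

/-- **Siu's theorem for currents with the singularities of an effective `ℝ`-divisor**: if the
cone potential of `T` differs by a locally bounded function from `Σₖ (aₖ/dₖ) log |Fₖ|`, then every
`E_c(T)` is an analytic subset of `ℙᴺ(ℂ)`. [cite: Siu1974, Main Theorem] -/
theorem isAnalyticSet_lelongUpperLevelSet_of_hasBoundedDifference_divisor {K : ℕ}
    {T : ClosedPositiveOneOneCurrent N} (F : Fin K → MvPolynomial (Fin (N + 1)) ℂ) (d : Fin K → ℕ)
    (hF : ∀ k, (F k).IsHomogeneous (d k)) (hd : ∀ k, 0 < d k) (hF0 : ∀ k, F k ≠ 0)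
    (a : Fin K → ℝ) (ha : ∀ k, 0 < a k)
    (h : T.HasBoundedDifference (ofHomogeneousPolynomials F d hF hd hF0 a ha)) (c : ℝ) :
    Literature.Geometry.Kaehler.IsAnalyticSet 𝓘(ℂ, Fin N → ℂ) (T.lelongUpperLevelSet c) :=
  h.isAnalyticSet_lelongUpperLevelSet
    (isAnalyticSet_lelongUpperLevelSet_ofHomogeneousPolynomials F d hF hd hF0 a ha c)

end ClosedPositiveOneOneCurrent

end Literature.Analysis.Pluripotential

end
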